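import Summits.QuantumFields.BalabanUV.Beta.GAN24.ContactOneGaugeCellLambda
import Summits.QuantumFields.BalabanUV.Beta.GAN24.TaylorTrilinearLattice

/-!
# `GAN24.ContactLambdaCommutator` — CT-ROUTE, BORNSEC-PLAN v1 §0 (c2)∕(c3) dictionary (row owner gan24-p1-g20, `HOME/b2b-balaban-gan24-p1/gen20/BORNSEC-PLAN-v1.md`):
# the ROOTED LINEAR AVERAGING EXPANDED OVER BONDS, the `q¹`-PAIRING OF A LEG = ITS ROOTED BLOCK AVERAGE (= straight block sum − coarse gradient), and
# THE GAUGE-WEIGHTED PAIRING OF THE Λ∕H COVARIANCE LAW = A COMMUTATOR `[𝒬^ρ_L, ψ̄]`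

HONEST FRAMING (cell charter, verbatim): «discharging `BetaPertH` makes Bałaban's UV stability UNCONDITIONAL — a real constructive-QFT result;
it is NOT the continuum limit and NOT the Clay problem.»  DERIVED cell leaf (pub-balaban, G-an2-4 formalisation swarm → CRUX TEAM (2), seat
`b2b-balaban-gan24-formalise-leaf-02`, gen 48): [folklore] bookkeeping over an1's node 5ρ∕7aρ (`AveragingContoursRooted.linAvgAt`, `AveragingHessianKernelsRooted.linKerAt`)
BY NAME; NO cited fact, NO `def`, NO `def … : Prop`, NO sorry, NO wall binder; every 1-form ∕ gauge function ARBITRARY.  Discharges NO letter of (CONV-C); it is the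
dictionary the owner's ruling R-gan24p1-g20-1 ∕ (W10) asks for («the partner factor `Σ_μ Σ'_y c♯(μy;κu)·(λ-weights)·q¹_{(μ,y)}(b,z)∕2` … q¹-pairing of the leg → next-level leg →
`HΦcol_pair_respStep`»), nothing more; NEVER «G-an2-4 closed»; NOT hS0, NOT D1, NOT `BetaPertH`, NOT continuum, NOT Clay.  «not in print; our bookkeeping».
HONEST DEPENDENCY (cell records, verbatim): «continuum YM on T⁴ ⇐ BetaPertH ∧ nine spine estimates (0/9 proved); BetaPertH ⇐ (D1) ∧ (D4) ∧ CAP+tail;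
G-an2-4 gates asym, D1 and NE2/3/4.»
ABSOLUTE RULE (cell charter, verbatim): «No internally-minted statement may enter as a cited fact. Every hypothesis is either kernel-proved in this
package or a verbatim quotation of a PUBLISHED theorem with page reference. The manuscript(s) under audit are NOT citable for their own disputed steps —
they are the thing under adjudication; programme-internal (2001/route/tribunal) claims are never citable.»

## What is proved (box root `ρ = toSite r`, `r ∈ box (d+1) L`; generic `d`; `q¹,ρ_{(μ,y)} = linKerAt ρ L μ y`)
* §1 **`linAvgAt_eq_sum_linCountAt`**: `linAvgAt ρ A L μ y = Σ_{x ∈ nearBox L y} Σ_α linCountAt ρ L μ y (α, x) · A α x` for EVERY real 1-form `A` — proved WITHOUT a locality lemma, by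
  UNIVERSAL COEFFICIENTS (`Bond →₀ ℤ`, an1's naturality `linAvgAt_mapForm`, `linAvgAt ρ (δ1 f) = linCountAt`, `linCountAt_eq_zero`); the PAIRING **`tsum_sum_linKerAt_mul`**
  `Σ'_x Σ_α q¹,ρ_{(μ,y)}(α, x)·A α x = (L^{d+1})⁻¹·linAvgAt ρ A L μ y` (`_mul_linKerAt` with the form on the left) and its ROOTED ∕ STRAIGHT SPLIT
  **`tsum_sum_linKerAt_mul_eq_contourSum_sub`** `= (L^{d+1})⁻¹·(contourSum L A μ y − dz (LamAt ρ A L) μ y)` (an1's `linAvgAt_eq_contourSum_sub_dz`; `contourSum` is the currency of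
  `respStep`, of `RespStepConstraint.contourSum_respStep` and of the tent `RespStepEffectiveEL.HΦcol_pair_respStep` — v1 §0 (c3) «q¹[B_i] = B_{i+1} up to the in-block gradient»).
* §2 **`tsum_sum_mul_gaugeWeight_mul_linKerAt`**: with the four-site weight of `HessianGaugeLegContact.tsum_dz_mul_SLam_hessFFAt` (v1 §0 (c2): «the deviation of ψ on the fine link
  from its value on the coarse link»), `Σ'_x Σ_α A α x·((ψ x + ψ(x+e_α) − ψ(L·y+ρ) − ψ(L·y+ρ+L·e_μ))·q¹,ρ_{(μ,y)}(α,x)∕2) = (2L^{d+1})⁻¹·(linAvgAt ρ (ψ̄•A) L μ y − Ψ̄_ρ(μ,y)·linAvgAt ρ A L μ y)`,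
  `(ψ̄•A) α x = (ψ x + ψ(x+e_α))·A α x`, `Ψ̄_ρ(μ,y) = ψ(L·y+ρ) + ψ(L·y+ρ+L·e_μ)` (written inline, no def) — the commutator `[𝒬^ρ_L, ψ̄] A`.
* §3 letters: `abs_sub_le_mul_l1_of_dz` (bounded gradient ⇒ ℓ¹-Lipschitz, road W3's `TaylorTrilinearLattice.abs_sub_le_of_unit_steps` at rate 0), **`abs_gaugeWeight_le`** (on the support of
  `q¹,ρ_{(μ,y)}(b,z)` the four-site weight is bounded by `G·(2(d+1)·2L + 1)` for a gauge function of gradient `≤ G`), `prox_of_near`.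
The cell-level consequences (the Λ one-gauge cell FACTORISED over the coarse bond, the bracket of the index leg against a tent coefficient) are `GAN24.ContactLambdaCellFactorised`.
NOT HERE: the `linSymAt` (V∕H-table) twin of §2 (same script on word); any estimate; any instance at the route's legs.
Provenance: seat b2b-balaban-gan24-formalise-leaf-02 gen 48 (prover-…-leaf-02-g48-0), 2026-08-21; over the files named above BY NAME.
-/

open Finset
open scoped BigOperators
open Literature.MathematicalPhysics.QuantumFieldTheory.Balaban1983to89
open Literature.MathematicalPhysics.QuantumFieldTheory.Balaban1983to89.Beta
open AffineAveraging AveragingContours AveragingHessianKernels AveragingContoursRooted AveragingHessianKernelsRooted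
open TransportedContourVariables (mapForm)
open Literature.MathematicalPhysics.QuantumFieldTheory.LatticeForm (quo)
open B12Sec2to5 (l1 l1_nonneg)
open StepJetData (l1_unitVec)
open AveragingWardStencils (b6UnitVec_eq)
open ExpKernelCalculus (l1_sub_triangle l1_sub_symm)
open Summit.QuantumFields.BalabanUV.Beta.GAN24.ContactBorderPartner (l1_farEnd_sub_le_of_mem)
open Summit.QuantumFields.BalabanUV.Beta.GAN24.ContactOneGaugeCellLambda (l1_root_sub_le_of_mem)
open Summit.QuantumFields.BalabanUV.Beta.GAN24.TaylorTrilinearLattice (abs_sub_le_of_unit_steps)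
open Summit.QuantumFields.BalabanUV.Beta.LinearGaugeVH (nearBox mem_nearBox summable_of_finsupp)

noncomputable section

namespace Summit.QuantumFields.BalabanUV.Beta.GAN24.ContactLambdaCommutator

variable {d : ℕ}

/-! ## §1 The rooted linear averaging expanded over bonds, and the `q¹`-pairing -/

section Expansion

variable {L : ℕ} {r : Fin (d + 1) → ℕ}

/-- [folklore] SUPPORT (box root): the rooted count `linCountAt` of a bond based outside the support box `nearBox L y` vanishes. -/
theorem linCountAt_eq_zero_of_not_mem (hr : r ∈ box (d + 1) L) (μ : Fin (d + 1)) {y x : Fin (d + 1) → ℤ}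
    (hx : x ∉ nearBox L y) (α : Fin (d + 1)) : linCountAt (toSite r) L μ y (α, x) = 0 :=
  linCountAt_eq_zero hr (f := (α, x)) fun h => hx (mem_nearBox.2 h)

/-- [folklore] SUPPORT (box root): `q¹,ρ_{(μ,y)}(α, x) = 0` for `x ∉ nearBox L y`. -/
theorem linKerAt_eq_zero_of_not_mem (hr : r ∈ box (d + 1) L) (μ : Fin (d + 1)) {y x : Fin (d + 1) → ℤ}
    (hx : x ∉ nearBox L y) (α : Fin (d + 1)) : linKerAt (toSite r) L μ y (α, x) = 0 :=
  linKerAt_eq_zero hr (f := (α, x)) fun h => hx (mem_nearBox.2 h)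

/-- [folklore] **THE ROOTED LINEAR AVERAGING EXPANDED OVER BONDS** (box root; EVERY real 1-form `A`, no support or summability hypothesis):
`linAvgAt ρ A L μ y = Σ_{x ∈ nearBox L y} Σ_α linCountAt ρ L μ y (α, x) · A α x`.  Proof by UNIVERSAL COEFFICIENTS: the 1-form
`U (κ, x) := [(κ, x)] ∈ (Bond →₀ ℤ)` specialises to `A` along the additive map `[f] ↦ A f` (an1's naturality `linAvgAt_mapForm`), its own
averaging has coefficient `linCountAt … f` at `[f]` (naturality along the evaluation at `f`, `linAvgAt ρ (δ1 f) = linCountAt`), and the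
coefficients vanish off the support box (`linCountAt_eq_zero`). -/
theorem linAvgAt_eq_sum_linCountAt (hr : r ∈ box (d + 1) L) (A : Form1 (d + 1) ℝ) (μ : Fin (d + 1)) (y : Fin (d + 1) → ℤ) :
    linAvgAt (toSite r) A L μ y = ∑ x ∈ nearBox L y, ∑ α, (linCountAt (toSite r) L μ y (α, x) : ℝ) * A α x := by
  classical
  -- universal coefficients
  let U : Form1 (d + 1) (Bond (d + 1) →₀ ℤ) := fun κ x => Finsupp.single (κ, x) 1
  let φ : (Bond (d + 1) →₀ ℤ) →+ ℝ := Finsupp.liftAddHom fun f => zmultiplesHom ℝ (A f.1 f.2)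
  have hA : mapForm φ U = A := by
    funext κ x
    show φ (Finsupp.single (κ, x) 1) = A κ x
    rw [Finsupp.liftAddHom_apply_single, zmultiplesHom_apply, one_zsmul]
  have hcoef : ∀ f : Bond (d + 1), linAvgAt (toSite r) U L μ y f = linCountAt (toSite r) L μ y f := by
    intro f
    have hUf : mapForm (Finsupp.applyAddHom f) U = δ1 f := by
      funext κ x
      show (Finsupp.single (κ, x) (1 : ℤ)) f = δ1 f κ x
      rw [Finsupp.single_apply, δ1_apply]
    have h := linAvgAt_mapForm (Finsupp.applyAddHom f) (toSite r) U L μ y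
    rw [hUf, Finsupp.applyAddHom_apply] at h
    rw [← h]
    rfl
  have h1 : linAvgAt (toSite r) (mapForm φ U) L μ y = φ (linAvgAt (toSite r) U L μ y) := linAvgAt_mapForm φ _ U L μ y
  rw [hA] at h1
  rw [h1, Finsupp.liftAddHom_apply, Finsupp.sum]
  have hsupp : (linAvgAt (toSite r) U L μ y).support ⊆ (Finset.univ : Finset (Fin (d + 1))) ×ˢ nearBox L y := by
    intro f hf
    rw [Finsupp.mem_support_iff, hcoef] at hf
    rw [Finset.mem_product]
    refine ⟨Finset.mem_univ _, mem_nearBox.2 ?_⟩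
    by_contra hn
    exact hf (linCountAt_eq_zero hr hn)
  rw [Finset.sum_subset hsupp, Finset.sum_product_right]
  · refine Finset.sum_congr rfl fun x _ => Finset.sum_congr rfl fun α _ => ?_
    rw [zmultiplesHom_apply, hcoef, zsmul_eq_mul]
  · intro f _ hf
    rw [Finsupp.notMem_support_iff.1 hf, map_zero]

/-- [folklore] The `q¹`-pairing integrand vanishes off the support box. -/
theorem sum_linKerAt_mul_eq_zero_of_not_mem (hr : r ∈ box (d + 1) L) (A : Form1 (d + 1) ℝ) (μ : Fin (d + 1))
    {y x : Fin (d + 1) → ℤ} (hx : x ∉ nearBox L y) : ∑ α, linKerAt (toSite r) L μ y (α, x) * A α x = 0 :=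
  Finset.sum_eq_zero fun α _ => by rw [linKerAt_eq_zero_of_not_mem hr μ hx α, zero_mul]

/-- [folklore] The `q¹`-pairing integrand is summable (finitely supported). -/
theorem summable_sum_linKerAt_mul (hr : r ∈ box (d + 1) L) (A : Form1 (d + 1) ℝ) (μ : Fin (d + 1)) (y : Fin (d + 1) → ℤ) :
    Summable fun x => ∑ α, linKerAt (toSite r) L μ y (α, x) * A α x :=
  summable_of_finsupp (nearBox L y) fun _ hx => sum_linKerAt_mul_eq_zero_of_not_mem hr A μ hx

/-- [folklore] **THE `q¹`-PAIRING OF A 1-FORM IS ITS ROOTED LINEAR AVERAGE** (box root; every real 1-form `A`):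
`Σ'_x Σ_α q¹,ρ_{(μ,y)}(α, x) · A α x = (L^{d+1})⁻¹ · linAvgAt ρ A L μ y`. -/
theorem tsum_sum_linKerAt_mul (hr : r ∈ box (d + 1) L) (A : Form1 (d + 1) ℝ) (μ : Fin (d + 1)) (y : Fin (d + 1) → ℤ) :
    ∑' x, ∑ α, linKerAt (toSite r) L μ y (α, x) * A α x = ((L : ℝ) ^ (d + 1))⁻¹ * linAvgAt (toSite r) A L μ y := by
  classical
  rw [tsum_eq_sum (s := nearBox L y) (fun _ hx => sum_linKerAt_mul_eq_zero_of_not_mem hr A μ hx),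
    linAvgAt_eq_sum_linCountAt hr A μ y, Finset.mul_sum]
  refine Finset.sum_congr rfl fun x _ => ?_
  rw [Finset.mul_sum]
  refine Finset.sum_congr rfl fun α _ => ?_
  rw [linKerAt, div_eq_inv_mul, mul_assoc]

/-- [folklore] The same with the 1-form on the left. -/
theorem tsum_sum_mul_linKerAt (hr : r ∈ box (d + 1) L) (A : Form1 (d + 1) ℝ) (μ : Fin (d + 1)) (y : Fin (d + 1) → ℤ) :
    ∑' x, ∑ α, A α x * linKerAt (toSite r) L μ y (α, x) = ((L : ℝ) ^ (d + 1))⁻¹ * linAvgAt (toSite r) A L μ y := by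
  rw [← tsum_sum_linKerAt_mul hr A μ y]
  exact tsum_congr fun x => Finset.sum_congr rfl fun α _ => mul_comm _ _

/-- [folklore] **THE ROOTED ∕ STRAIGHT SPLIT OF THE PAIRING** (an1's `linAvgAt_eq_contourSum_sub_dz`): the `q¹`-pairing is the STRAIGHT-contour
block sum `𝒬_L A` (an2's `contourSum`, the currency of `respStep` and of the tent `HΦcol_pair_respStep`) MINUS the coarse gradient of the rooted
block potential `Λ^ρ A`. -/
theorem tsum_sum_linKerAt_mul_eq_contourSum_sub (hr : r ∈ box (d + 1) L) (A : Form1 (d + 1) ℝ) (μ : Fin (d + 1))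
    (y : Fin (d + 1) → ℤ) :
    ∑' x, ∑ α, linKerAt (toSite r) L μ y (α, x) * A α x
      = ((L : ℝ) ^ (d + 1))⁻¹ * (contourSum L A μ y - dz (LamAt (toSite r) A L) μ y) := by
  rw [tsum_sum_linKerAt_mul hr, linAvgAt_eq_contourSum_sub_dz]

end Expansion

/-! ## §2 The gauge-weighted pairing is a commutator of the rooted averaging with the bond mean of the gauge function -/

section Commutator

variable {L : ℕ} {r : Fin (d + 1) → ℕ}

/-- [folklore] **THE GAUGE-WEIGHTED `q¹`-PAIRING IS A COMMUTATOR** (box root; every `ψ`, every real 1-form `A`): with the four-site weight of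
`HessianGaugeLegContact.tsum_dz_mul_SLam_hessFFAt`,
`Σ'_x Σ_α A α x · ((ψ x + ψ(x + e_α) − ψ(L·y + ρ) − ψ(L·y + ρ + L·e_μ)) · q¹,ρ_{(μ,y)}(α, x) ∕ 2)`
`= (2L^{d+1})⁻¹ · (linAvgAt ρ (ψ̄•A) L μ y − Ψ̄_ρ(μ, y) · linAvgAt ρ A L μ y)`, `(ψ̄•A) α x = (ψ x + ψ(x + e_α))·A α x`,
`Ψ̄_ρ(μ, y) = ψ(L·y + ρ) + ψ(L·y + ρ + L·e_μ)` — the rooted average of the bond-mean-weighted form minus the coarse bond mean times the rooted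
average: `[𝒬^ρ_L, ψ̄] A`. -/
theorem tsum_sum_mul_gaugeWeight_mul_linKerAt (hr : r ∈ box (d + 1) L) (ψ : (Fin (d + 1) → ℤ) → ℝ) (A : Form1 (d + 1) ℝ)
    (μ : Fin (d + 1)) (y : Fin (d + 1) → ℤ) :
    ∑' x, ∑ α, A α x *
        ((ψ x + ψ (x + unitVec α) - ψ ((L : ℤ) • y + toSite r) - ψ ((L : ℤ) • y + toSite r + (L : ℤ) • unitVec μ))
          * linKerAt (toSite r) L μ y (α, x) / 2)
      = (2 * (L : ℝ) ^ (d + 1))⁻¹ *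
          (linAvgAt (toSite r) (fun α x => (ψ x + ψ (x + unitVec α)) * A α x) L μ y
            - (ψ ((L : ℤ) • y + toSite r) + ψ ((L : ℤ) • y + toSite r + (L : ℤ) • unitVec μ)) * linAvgAt (toSite r) A L μ y) := by
  set Ψ : ℝ := ψ ((L : ℤ) • y + toSite r) + ψ ((L : ℤ) • y + toSite r + (L : ℤ) • unitVec μ) with hΨ
  have h1 := tsum_sum_linKerAt_mul hr (fun α x => (ψ x + ψ (x + unitVec α)) * A α x) μ y
  have h2 := tsum_sum_linKerAt_mul hr A μ y
  have hs1 := summable_sum_linKerAt_mul hr (fun α x => (ψ x + ψ (x + unitVec α)) * A α x) μ y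
  have hs2 := summable_sum_linKerAt_mul hr A μ y
  have hpt : ∀ x, ∑ α, A α x *
      ((ψ x + ψ (x + unitVec α) - ψ ((L : ℤ) • y + toSite r) - ψ ((L : ℤ) • y + toSite r + (L : ℤ) • unitVec μ))
        * linKerAt (toSite r) L μ y (α, x) / 2)
      = (1 / 2) * (∑ α, linKerAt (toSite r) L μ y (α, x) * ((ψ x + ψ (x + unitVec α)) * A α x))
          - (Ψ / 2) * ∑ α, linKerAt (toSite r) L μ y (α, x) * A α x := by
    intro x
    rw [Finset.mul_sum, Finset.mul_sum, ← Finset.sum_sub_distrib]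
    refine Finset.sum_congr rfl fun α _ => ?_
    rw [hΨ]; ring
  rw [tsum_congr hpt, (hs1.mul_left _).tsum_sub (hs2.mul_left _), tsum_mul_left, tsum_mul_left, h1, h2]
  have hL : (2 * (L : ℝ) ^ (d + 1))⁻¹ = (1 / 2) * ((L : ℝ) ^ (d + 1))⁻¹ := by rw [mul_inv, one_div]
  rw [hL]; ring

end Commutator

/-! ## §3 Letters of the four-site weight of the covariance law -/

section Letters

variable {L : ℕ} {r : Fin (d + 1) → ℕ}

/-- [folklore] A BOUNDED GRADIENT MAKES `ψ` ℓ¹-LIPSCHITZ: `|ψ b − ψ a| ≤ G·|b − a|₁` (lattice-path telescoping,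
`TaylorTrilinearLattice.abs_sub_le_of_unit_steps` at rate `0`). -/
theorem abs_sub_le_mul_l1_of_dz {ψ : (Fin (d + 1) → ℤ) → ℝ} {G : ℝ} (hψ : ∀ κ x, |dz ψ κ x| ≤ G)
    (a b : Fin (d + 1) → ℤ) : |ψ b - ψ a| ≤ G * l1 (b - a) := by
  have hG : 0 ≤ G := (abs_nonneg _).trans (hψ 0 0)
  have hF : ∀ (z : Fin (d + 1) → ℤ) (ν : Fin (d + 1)),
      |ψ (z + Pi.single ν 1) - ψ z| ≤ G * Real.exp (-(0 : ℝ) * l1 (quo 1 z - 0)) := fun z ν => by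
    rw [neg_zero, zero_mul, Real.exp_zero, mul_one]
    exact hψ ν z
  have h := abs_sub_le_of_unit_steps 1 hG le_rfl hF a (b - a)
  simp only [neg_zero, zero_mul, Real.exp_zero, mul_one, add_sub_cancel] at h
  rw [mul_comm]
  exact h

/-- [folklore] **THE FOUR-SITE WEIGHT IS BOUNDED ON THE SUPPORT OF `q¹`** (box root; `y` near `z`; gauge function of bounded gradient `G`):
`|ψ z + ψ(z + e_b) − ψ(L·y + ρ) − ψ(L·y + ρ + L·e_μ)| ≤ G·(2·(d+1)·2L + 1)` — two differences of `ψ` across at most `(d+1)·2L` resp.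
`(d+1)·2L + 1` unit steps (`ContactOneGaugeCellLambda.l1_root_sub_le_of_mem`, `ContactBorderPartner.l1_farEnd_sub_le_of_mem`). -/
theorem abs_gaugeWeight_le (hr : r ∈ box (d + 1) L) {ψ : (Fin (d + 1) → ℤ) → ℝ} {G : ℝ} (hψ : ∀ κ x, |dz ψ κ x| ≤ G)
    {y z : Fin (d + 1) → ℤ} (hyz : ∀ i, z i - 2 * (L : ℤ) < (L : ℤ) * y i ∧ (L : ℤ) * y i ≤ z i) (b μ : Fin (d + 1)) :
    |ψ z + ψ (z + unitVec b) - ψ ((L : ℤ) • y + toSite r) - ψ ((L : ℤ) • y + toSite r + (L : ℤ) • unitVec μ)|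
      ≤ G * (2 * (((d : ℝ) + 1) * (2 * (L : ℝ))) + 1) := by
  have hG : 0 ≤ G := (abs_nonneg _).trans (hψ 0 0)
  have h1 : |ψ z - ψ ((L : ℤ) • y + toSite r)| ≤ G * (((d : ℝ) + 1) * (2 * (L : ℝ))) := by
    refine (abs_sub_le_mul_l1_of_dz hψ _ z).trans (mul_le_mul_of_nonneg_left ?_ hG)
    rw [l1_sub_symm]
    exact l1_root_sub_le_of_mem hr hyz
  have h2 : |ψ (z + unitVec b) - ψ ((L : ℤ) • y + toSite r + (L : ℤ) • unitVec μ)|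
      ≤ G * (((d : ℝ) + 1) * (2 * (L : ℝ)) + 1) := by
    refine (abs_sub_le_mul_l1_of_dz hψ _ (z + unitVec b)).trans (mul_le_mul_of_nonneg_left ?_ hG)
    calc l1 (z + unitVec b - ((L : ℤ) • y + toSite r + (L : ℤ) • unitVec μ))
        ≤ l1 (z + unitVec b - z) + l1 (z - ((L : ℤ) • y + toSite r + (L : ℤ) • unitVec μ)) := l1_sub_triangle _ _ _
      _ = 1 + l1 (z - ((L : ℤ) • y + toSite r + (L : ℤ) • unitVec μ)) := by
          rw [add_sub_cancel_left, ← b6UnitVec_eq, l1_unitVec]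
      _ ≤ 1 + ((d : ℝ) + 1) * (2 * (L : ℝ)) := by
          rw [l1_sub_symm]
          have := l1_farEnd_sub_le_of_mem hr hyz μ
          linarith
      _ = ((d : ℝ) + 1) * (2 * (L : ℝ)) + 1 := add_comm _ _
  calc |ψ z + ψ (z + unitVec b) - ψ ((L : ℤ) • y + toSite r) - ψ ((L : ℤ) • y + toSite r + (L : ℤ) • unitVec μ)|
      = |(ψ z - ψ ((L : ℤ) • y + toSite r)) + (ψ (z + unitVec b) - ψ ((L : ℤ) • y + toSite r + (L : ℤ) • unitVec μ))| := by
        ring_nf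
    _ ≤ |ψ z - ψ ((L : ℤ) • y + toSite r)| + |ψ (z + unitVec b) - ψ ((L : ℤ) • y + toSite r + (L : ℤ) • unitVec μ)| :=
        abs_add_le _ _
    _ ≤ G * (((d : ℝ) + 1) * (2 * (L : ℝ))) + G * (((d : ℝ) + 1) * (2 * (L : ℝ)) + 1) := add_le_add h1 h2
    _ = G * (2 * (((d : ℝ) + 1) * (2 * (L : ℝ))) + 1) := by ring

/-- [folklore] `Near L y z` in the strict form used by the proximity lemmas. -/
theorem prox_of_near {y z : Fin (d + 1) → ℤ} (h : Near L y z) (i : Fin (d + 1)) :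
    z i - 2 * (L : ℤ) < (L : ℤ) * y i ∧ (L : ℤ) * y i ≤ z i := by
  have h1 := (h i).1
  have h2 := (h i).2
  constructor <;> omega

end Letters

end Summit.QuantumFields.BalabanUV.Beta.GAN24.ContactLambdaCommutator

end
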